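import Summits.CriticalPhenomena.PercolationContinuityZ3.Theorems.PercNearOneGluingNoHeavyLowerTailSahiC4CubeColourCheck

/-!
# The 4-coloured-antichain check of the FOUR-cube: `colourCheck4 4 22 = true` (one `native_decide`, ≈ 5 s)

Support file (cell `prim-sahi`, seat `prim-sahi-typer` gen 33; `--supports stmt-CriticalPhenomena-4575`; COMPUTATIONAL: the single theorem is a
`native_decide` evaluation, axiom `Lean.ofReduceBool` via `colourCheck4_four._native…`).

Typer gen 28's checker `SahiC4Cube.colourCheck4 m σ` (…`SahiC4CubeColourCheck`) runs prim-sahi-p1's order-4 tensor-Bernstein DIGIT TEST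
`checkQuad` (coefficient bound `24·16^m < 2^(σ−1)`; here `m = 4`, `24·16^4 = 1 572 864 < 2^21`, so `σ = 22`) over the quadruples co-generated by
the restricted-growth 4-coloured antichains of `2^[m]`, accepting a leaf outright when a colour class is empty.  The tree evaluates it at `m = 5`
(`colourCheck4_five`, six chunks) for the VALUE-level `sahiC4_cube_five`; at `m = 4` the value-level `sahiC4_cube_four` went through a different
certificate (`checkNA_four` on the non-absorbing quadruples + Theorem E).  The `m = 4` evaluation here feeds the COMB-level reading of the
check (…`SahiC4CombCubeFive`, this generation: `colourCheck4 m σ` + (M⁺-3) on `Fin m` ⟹ (M⁺-4) on `Fin m` by the comb-level saturation), which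
needs the four-cube to cover every ground set of size `≤ 5`. [this work]
-/

namespace Summit.CriticalPhenomena.PercolationContinuityZ3.Theorems.SahiC4Cube

/-- **`colourCheck4 4 22 = true`**: the order-4 digit test passes on every quadruple co-generated by a 4-coloured antichain of `2^[4]`
(one `native_decide` evaluation). [this work] [computational] -/
theorem colourCheck4_four : colourCheck4 4 22 = true := by
  native_decide

end Summit.CriticalPhenomena.PercolationContinuityZ3.Theorems.SahiC4Cube
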